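/-
Copyright (c) 2026 the pub-hodgecm-mathlib formalisation cell (harness21).  Prover seat hodgecm-mathlib-K2Liu-p13 (g0), Track B «K2-LIT»,
#184♮ = hLiu418 = `stmt-HodgeConjecture-24832`; Road I v3 organ U1-CT-ind STAGE 2 (Q2), file F4-1c (LEAD F0P6-plan (g13) 09:57:20Z «GO (Q2) F4 → F5 → D-U1 stage 3»).
-/
import Summits.HodgeConjecture.HodgeConjecture.Theorems.K2LiuDoubledAntidiagonalTransportRational   -- ★∕📤 F3″: `isSiegelDelta_transport_iff`, `transport_symm_mem_range`, `transport_mem_ratH`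
import Summits.HodgeConjecture.HodgeConjecture.Theorems.K2LiuKlingenUnipotentAdelicDefs             -- ★ F4-1: `jAdelic`, `klingenUnipA`
import Summits.HodgeConjecture.HodgeConjecture.Theorems.K2LiuKlingenBruhatTwoCells                   -- ★ F2: `siegel_klingen_dichotomy`
import HarnessLib

/-!
# Crux `HLiu418`, Road I v3, organ U1 stage 2 (Q2), file F4-1c: THE RATIONAL LETTERS THROUGH THE TRANSPORT AND THE TWO CELLS OF `H(L⁺)` —
# every `γ ∈ H(L⁺)` is `Ψ(p)·Ψ(q)` or `Ψ(p)·Ψ(ξ)·Ψ(q)` with `p ∈ P(L⁺)`, `q ∈ Q(L⁺)` rational letters of `U(J₄)`, and `Ψ(P(L⁺)) ⊂ P_Δ(𝔸)`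

Cell `hodgecm-mathlib`, crux item hLiu418 = `stmt-HodgeConjecture-24832`; squad K2 ∕ K2Liu; LEAD F0P6-plan (g13), co-dealer K2E5-plan (g7); prover K2Liu-p13 (g0).
THEOREMS ONLY (no `def`, no instance, no notation, no named-fact hypothesis, no `sorry`); lane `--supports stmt-HodgeConjecture-24832 --as helper` (count-neutral).
The transport `Ψ` and ★ F3's clauses (T1)(T3) (+ `XY = YX = a·1`) are hypotheses BY VALUE.  B1a's letters at `R := L`, `σ := c` ARE the tree's rational points
`UnitaryGroup.rational L⁺ L c 4 (J₄ ⊗ L)` (definitionally), read in `H(𝔸)` through `Ψ ∘ toAdelic`.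
* §1 (generic `N`) `coe_adelicVal_toAdelic` (the matrix of `toAdelic g` is `g.map (L ↪ 𝔸_L)`), `toAdelic_injective'`, `c` is an involution of `L` (`complexConj_ringHom_apply_apply`).
* §2 (`n = 2`) **`isSiegelDelta_transport_toAdelic_of_mem_siegelFour`**: `p ∈ P(L⁺) = siegelFour L c ⇒ Ψ(toAdelic p) ∈ P_Δ(𝔸)` (📤 F3″ `isSiegelDelta_transport_iff`: the
  lower-left `e₂`-block of `p.map ι` vanishes, `toBlocks₂₁_eq_zero_of_mem_siegelFour`), and it is rational (📤 F3″ `transport_mem_ratH`), so it lies in `siegelDeltaRat`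
  and is invisible in `P_Δ(L⁺)\H(L⁺)` (`mk_transport_siegelFour_mul`).
* §3 (`n = 2`) **`ratH_two_cells`**: every `γ ∈ H(L⁺)` is `Ψ(toAdelic p)·Ψ(toAdelic q)` (cell `1`) or `Ψ(toAdelic p)·Ψ(toAdelic ξ)·Ψ(toAdelic q)` (cell `ξ`) with `p ∈ siegelFour L c`,
  `q ∈ klingen L c` (★ F2 `siegel_klingen_dichotomy` at `K := L` pulled through 📤 F3″ `transport_symm_mem_range`), and NOT BOTH (`ratH_two_cells_disjoint`, ★ F2 + `Ψ`,
  `toAdelic` injective); hence every class of `SiegelDeltaQuot = P_Δ(L⁺)\H(L⁺)` has a representative `Ψ(toAdelic q)` or `Ψ(toAdelic (ξ q))`, `q ∈ Q(L⁺)`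
  (`siegelDeltaQuot_two_cells`) — the index sets of the two cells of the Q-constant term (file F4).
[Xiong2013 §7 L. 7.1 (`G = PQ ∪ PξQ`)], [GanTakeda2011SiegelWeil §7.2], [MoeglinWaldspurger1995 II.1.7], [GelbartRogawski1991 §3.1].
HONEST LABEL.  Count-neutral helper: `HC_CM` is proved only modulo the 7 printed citations (2 remaining named inputs: hLiu418 = `stmt-HodgeConjecture-24832`,
h413 = `stmt-HodgeConjecture-24833`) until rung 0 closes.
-/

set_option autoImplicit false
set_option linter.dupNamespace false -- the mandated namespace repeats `HodgeConjecture.HodgeConjecture`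

noncomputable section

open scoped Matrix
open NumberField IsDedekindDomain

namespace Summit.HodgeConjecture.HodgeConjecture.Cruxes.HLiu418.K2LiuKlingenRationalCells

open Literature.NumberTheory.Automorphic Literature.NumberTheory.Automorphic.UnitaryGroup
open Literature.NumberTheory.GelbartRogawski1991 Literature.NumberTheory.GelbartRogawski1991.GRConstruction
open Literature.NumberTheory.GaloisRepresentations
open Literature.NumberTheory.K2Lit.SiegelDoubled
open Summit.HodgeConjecture.HodgeConjecture.Cruxes.HLiu418.K2LiuDoubledUTwoTwoBorelFrame
open Summit.HodgeConjecture.HodgeConjecture.Cruxes.HLiu418.K2LiuKlingenParabolicDefs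
open Summit.HodgeConjecture.HodgeConjecture.Cruxes.HLiu418.K2LiuKlingenBruhatTwoCells (siegel_klingen_dichotomy)
open Summit.HodgeConjecture.HodgeConjecture.Cruxes.HLiu418.K2LiuDoubledAntidiagonalTransportRational (isSiegelDelta_transport_iff transport_mem_ratH transport_symm_mem_range)
open UnitaryDualPair

/-! ## §1 Rational letters read in `𝔸` (generic `N`) -/

variable (L : Type) [Field L] [NumberField L] [IsCMField L]

/-- `c` is an involution of `L` (the `hσ` of B1a's letters at `R := L`). [cite: Mok2014, §1 Notation p. 5] -/
theorem complexConj_ringHom_apply_apply (x : L) :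
    ((IsCMField.complexConj L : L ≃ₐ[Fp L] L) : L →+* L) (((IsCMField.complexConj L : L ≃ₐ[Fp L] L) : L →+* L) x) = x :=
  IsCMField.complexConj_apply_apply L x

/-- **the matrix of `toAdelic g` is `g.map (L ↪ 𝔸_L)`**. [cite: Mok2014, §1 Notation p. 5] -/
theorem coe_adelicVal_toAdelic (N : ℕ) (g : UnitaryGroup.rational (Fp L) L (IsCMField.complexConj L) N ((StdForm.antidiagonal N).over L)) :
    ((adelicVal (Fp L) L (IsCMField.complexConj L) N _ (UnitaryGroup.toAdelic (Fp L) L (IsCMField.complexConj L) N ((StdForm.antidiagonal N).over L) g) :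
        GL (Fin N) (AdeleRing (𝓞 L) L)) : Matrix (Fin N) (Fin N) (AdeleRing (𝓞 L) L)) =
      ((g : GL (Fin N) L) : Matrix (Fin N) (Fin N) L).map (algebraMap L (AdeleRing (𝓞 L) L)) := by
  ext i j
  rfl

/-- `toAdelic` is injective (the diagonal embedding `L ↪ 𝔸_L` is). [cite: Mok2014, §1 Notation p. 5] -/
theorem toAdelic_injective' (N : ℕ) :
    Function.Injective (UnitaryGroup.toAdelic (Fp L) L (IsCMField.complexConj L) N ((StdForm.antidiagonal N).over L)) := by
  intro g g' h
  have hm := congrArg (fun x => ((adelicVal (Fp L) L (IsCMField.complexConj L) N _ x : GL (Fin N) (AdeleRing (𝓞 L) L)) : Matrix (Fin N) (Fin N) (AdeleRing (𝓞 L) L))) h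
  simp only [coe_adelicVal_toAdelic] at hm
  exact Subtype.ext (Units.ext (Matrix.map_injective (NumberField.AdeleRing.algebraMap_injective (𝓞 L) L) hm))

/-! ## §2 `Ψ(P(L⁺)) ⊂ P_Δ(𝔸) ∩ H(L⁺)` (`n = 2`) -/

section Generic

variable {R S : Type*} [CommRing R] [CommRing S] {σ : R →+* R}

/-- for `p` in the Siegel parabolic of `U(J₄)` the lower-left `e₂`-block of `p.map f` vanishes. [cite: HarrisKudlaSweet1996, §1 (1.11)] -/
theorem toBlocks₂₁_eq_zero_of_mem_siegelFour (f : R →+* S) {p : unitaryGroupOfForm σ ((StdForm.antidiagonal 4).over R)} (hp : p ∈ siegelFour R σ) :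
    (Matrix.reindex (e₂ (n := 2)).symm (e₂ (n := 2)).symm (((p : GL (Fin 4) R) : Matrix (Fin 4) (Fin 4) R).map f)).toBlocks₂₁ = 0 := by
  obtain ⟨h20, h21, h30, h31⟩ := hp
  have key : ∀ i j : Fin 2, ((p : GL (Fin 4) R) : Matrix (Fin 4) (Fin 4) R) (Fin.natAdd 2 i) (Fin.castAdd 2 j) = 0 := by
    intro i j
    fin_cases i <;> fin_cases j
    exacts [h20, h21, h30, h31]
  ext i j
  simp only [Matrix.toBlocks₂₁, Matrix.of_apply, Matrix.reindex_apply, Equiv.symm_symm, Matrix.submatrix_apply, Matrix.map_apply,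
    finSumFinEquiv_apply_right, finSumFinEquiv_apply_left, key, map_zero, Matrix.zero_apply]

end Generic

variable {L}
variable {N M : ℕ} {e : Fin N × Fin M ≃ Fin 2}
  {dV : Fin N → L} {hdV : ∀ i, IsCMField.complexConj L (dV i) = dV i}
  {dW : Fin M → L} {hdW : ∀ i, IsCMField.complexConj L (dW i) = dW i}

/-- **`Ψ(toAdelic p) ∈ P_Δ(𝔸)` for `p ∈ P(L⁺) = siegelFour L c`** (📤 F3″ `isSiegelDelta_transport_iff`). [cite: HarrisKudlaSweet1996, §1 (1.11)–(1.12)] [cite: Xiong2013, §7 Lemma 7.1] -/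
theorem isSiegelDelta_transport_toAdelic_of_mem_siegelFour {SA : GL (Fin (2 + 2)) (AdeleRing (𝓞 L) L)}
    {Ψ : (quasiSplit (Fp L) L (IsCMField.complexConj L) (2 + 2)).Adelic ≃ₜ* HA L e dV hdV dW hdW} {X Y : Matrix (Fin 2) (Fin 2) (Fp L)} {a : Fp L}
    (hΨ : ∀ g : (quasiSplit (Fp L) L (IsCMField.complexConj L) (2 + 2)).Adelic,
      (((Ψ g : HA L e dV hdV dW hdW) : GL (Fin (2 + 2)) (AdeleRing (𝓞 L) L)) : Matrix (Fin (2 + 2)) (Fin (2 + 2)) (AdeleRing (𝓞 L) L)) =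
        (SA : Matrix (Fin (2 + 2)) (Fin (2 + 2)) (AdeleRing (𝓞 L) L)) *
          ((adelicVal (Fp L) L (IsCMField.complexConj L) (2 + 2) _ g : GL (Fin (2 + 2)) (AdeleRing (𝓞 L) L)) :
            Matrix (Fin (2 + 2)) (Fin (2 + 2)) (AdeleRing (𝓞 L) L)) *
          ((SA⁻¹ : GL (Fin (2 + 2)) (AdeleRing (𝓞 L) L)) : Matrix (Fin (2 + 2)) (Fin (2 + 2)) (AdeleRing (𝓞 L) L)))
    (ha : a + a = 1)
    (hSA : Matrix.reindex (e₂ (n := 2)).symm (e₂ (n := 2)).symm (SA : Matrix (Fin (2 + 2)) (Fin (2 + 2)) (AdeleRing (𝓞 L) L)) =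
      Matrix.fromBlocks (1 : Matrix (Fin 2) (Fin 2) (AdeleRing (𝓞 L) L)) (X.map ((algebraMap L (AdeleRing (𝓞 L) L)).comp (algebraMap (Fp L) L))) 1
        (-(X.map ((algebraMap L (AdeleRing (𝓞 L) L)).comp (algebraMap (Fp L) L)))))
    (hSAi : Matrix.reindex (e₂ (n := 2)).symm (e₂ (n := 2)).symm ((SA⁻¹ : GL (Fin (2 + 2)) (AdeleRing (𝓞 L) L)) : Matrix (Fin (2 + 2)) (Fin (2 + 2)) (AdeleRing (𝓞 L) L)) =
      Matrix.fromBlocks ((a • (1 : Matrix (Fin 2) (Fin 2) (Fp L))).map ((algebraMap L (AdeleRing (𝓞 L) L)).comp (algebraMap (Fp L) L)))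
        ((a • (1 : Matrix (Fin 2) (Fin 2) (Fp L))).map ((algebraMap L (AdeleRing (𝓞 L) L)).comp (algebraMap (Fp L) L)))
        (Y.map ((algebraMap L (AdeleRing (𝓞 L) L)).comp (algebraMap (Fp L) L)))
        (-(Y.map ((algebraMap L (AdeleRing (𝓞 L) L)).comp (algebraMap (Fp L) L)))))
    (hYX : Y * X = a • (1 : Matrix (Fin 2) (Fin 2) (Fp L)))
    {p : unitaryGroupOfForm ((IsCMField.complexConj L : L ≃ₐ[Fp L] L) : L →+* L) ((StdForm.antidiagonal 4).over L)}
    (hp : p ∈ siegelFour L ((IsCMField.complexConj L : L ≃ₐ[Fp L] L) : L →+* L)) :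
    IsSiegelDelta L e dV hdV dW hdW (Ψ (UnitaryGroup.toAdelic (Fp L) L (IsCMField.complexConj L) (2 + 2) ((StdForm.antidiagonal (2 + 2)).over L) p)) := by
  refine (isSiegelDelta_transport_iff hΨ ha hSA hSAi hYX _).2 ?_
  rw [coe_adelicVal_toAdelic L (2 + 2) p]
  exact toBlocks₂₁_eq_zero_of_mem_siegelFour _ hp

/-- **`Ψ(toAdelic g) ∈ H(L⁺)`** for every rational letter `g ∈ U(J₄)(L⁺)` (📤 F3″ `transport_mem_ratH`). [cite: GelbartRogawski1991, §3.1] -/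
theorem transport_toAdelic_mem_ratH {SA : GL (Fin (2 + 2)) (AdeleRing (𝓞 L) L)}
    {Ψ : (quasiSplit (Fp L) L (IsCMField.complexConj L) (2 + 2)).Adelic ≃ₜ* HA L e dV hdV dW hdW} {X Y : Matrix (Fin 2) (Fin 2) (Fp L)} {a : Fp L}
    (hΨ : ∀ g : (quasiSplit (Fp L) L (IsCMField.complexConj L) (2 + 2)).Adelic,
      (((Ψ g : HA L e dV hdV dW hdW) : GL (Fin (2 + 2)) (AdeleRing (𝓞 L) L)) : Matrix (Fin (2 + 2)) (Fin (2 + 2)) (AdeleRing (𝓞 L) L)) =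
        (SA : Matrix (Fin (2 + 2)) (Fin (2 + 2)) (AdeleRing (𝓞 L) L)) *
          ((adelicVal (Fp L) L (IsCMField.complexConj L) (2 + 2) _ g : GL (Fin (2 + 2)) (AdeleRing (𝓞 L) L)) :
            Matrix (Fin (2 + 2)) (Fin (2 + 2)) (AdeleRing (𝓞 L) L)) *
          ((SA⁻¹ : GL (Fin (2 + 2)) (AdeleRing (𝓞 L) L)) : Matrix (Fin (2 + 2)) (Fin (2 + 2)) (AdeleRing (𝓞 L) L)))
    (ha : a + a = 1)
    (hSA : Matrix.reindex (e₂ (n := 2)).symm (e₂ (n := 2)).symm (SA : Matrix (Fin (2 + 2)) (Fin (2 + 2)) (AdeleRing (𝓞 L) L)) =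
      Matrix.fromBlocks (1 : Matrix (Fin 2) (Fin 2) (AdeleRing (𝓞 L) L)) (X.map ((algebraMap L (AdeleRing (𝓞 L) L)).comp (algebraMap (Fp L) L))) 1
        (-(X.map ((algebraMap L (AdeleRing (𝓞 L) L)).comp (algebraMap (Fp L) L)))))
    (hSAi : Matrix.reindex (e₂ (n := 2)).symm (e₂ (n := 2)).symm ((SA⁻¹ : GL (Fin (2 + 2)) (AdeleRing (𝓞 L) L)) : Matrix (Fin (2 + 2)) (Fin (2 + 2)) (AdeleRing (𝓞 L) L)) =
      Matrix.fromBlocks ((a • (1 : Matrix (Fin 2) (Fin 2) (Fp L))).map ((algebraMap L (AdeleRing (𝓞 L) L)).comp (algebraMap (Fp L) L)))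
        ((a • (1 : Matrix (Fin 2) (Fin 2) (Fp L))).map ((algebraMap L (AdeleRing (𝓞 L) L)).comp (algebraMap (Fp L) L)))
        (Y.map ((algebraMap L (AdeleRing (𝓞 L) L)).comp (algebraMap (Fp L) L)))
        (-(Y.map ((algebraMap L (AdeleRing (𝓞 L) L)).comp (algebraMap (Fp L) L)))))
    (hXY : X * Y = a • (1 : Matrix (Fin 2) (Fin 2) (Fp L))) (hYX : Y * X = a • (1 : Matrix (Fin 2) (Fin 2) (Fp L)))
    (g : unitaryGroupOfForm ((IsCMField.complexConj L : L ≃ₐ[Fp L] L) : L →+* L) ((StdForm.antidiagonal 4).over L)) :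
    Ψ (UnitaryGroup.toAdelic (Fp L) L (IsCMField.complexConj L) (2 + 2) ((StdForm.antidiagonal (2 + 2)).over L) g) ∈ ratH L e dV hdV dW hdW :=
  transport_mem_ratH hΨ ha hSA hSAi hXY hYX ⟨g, rfl⟩

/-- `Ψ ∘ toAdelic` is multiplicative on B1a's rational letters (the letters' product read in `H(𝔸)`). [cite: Mok2014, §1 Notation p. 5] -/
theorem transport_toAdelic_mul (Ψ : (quasiSplit (Fp L) L (IsCMField.complexConj L) (2 + 2)).Adelic ≃ₜ* HA L e dV hdV dW hdW)
    (p q : unitaryGroupOfForm ((IsCMField.complexConj L : L ≃ₐ[Fp L] L) : L →+* L) ((StdForm.antidiagonal 4).over L)) :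
    Ψ (UnitaryGroup.toAdelic (Fp L) L (IsCMField.complexConj L) (2 + 2) ((StdForm.antidiagonal (2 + 2)).over L)
        (p * q : unitaryGroupOfForm ((IsCMField.complexConj L : L ≃ₐ[Fp L] L) : L →+* L) ((StdForm.antidiagonal 4).over L))) =
      Ψ (UnitaryGroup.toAdelic (Fp L) L (IsCMField.complexConj L) (2 + 2) ((StdForm.antidiagonal (2 + 2)).over L) p) *
        Ψ (UnitaryGroup.toAdelic (Fp L) L (IsCMField.complexConj L) (2 + 2) ((StdForm.antidiagonal (2 + 2)).over L) q) := by
  have h1 : UnitaryGroup.toAdelic (Fp L) L (IsCMField.complexConj L) (2 + 2) ((StdForm.antidiagonal (2 + 2)).over L)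
        (p * q : unitaryGroupOfForm ((IsCMField.complexConj L : L ≃ₐ[Fp L] L) : L →+* L) ((StdForm.antidiagonal 4).over L)) =
      UnitaryGroup.toAdelic (Fp L) L (IsCMField.complexConj L) (2 + 2) ((StdForm.antidiagonal (2 + 2)).over L) p *
        UnitaryGroup.toAdelic (Fp L) L (IsCMField.complexConj L) (2 + 2) ((StdForm.antidiagonal (2 + 2)).over L) q :=
    map_mul _ _ _
  rw [h1]
  exact map_mul Ψ _ _

/-- **`Ψ(P(L⁺))` is invisible in `P_Δ(L⁺)\H(L⁺)`**: `⟦Ψ(toAdelic p) · γ⟧ = ⟦γ⟧` in `SiegelDeltaQuot` for `p ∈ siegelFour L c`, `γ ∈ H(L⁺)`.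
[cite: Xiong2013, §7 Lemma 7.1] [cite: MoeglinWaldspurger1995, II.1.7] -/
theorem mk_transport_siegelFour_mul {SA : GL (Fin (2 + 2)) (AdeleRing (𝓞 L) L)}
    {Ψ : (quasiSplit (Fp L) L (IsCMField.complexConj L) (2 + 2)).Adelic ≃ₜ* HA L e dV hdV dW hdW} {X Y : Matrix (Fin 2) (Fin 2) (Fp L)} {a : Fp L}
    (hΨ : ∀ g : (quasiSplit (Fp L) L (IsCMField.complexConj L) (2 + 2)).Adelic,
      (((Ψ g : HA L e dV hdV dW hdW) : GL (Fin (2 + 2)) (AdeleRing (𝓞 L) L)) : Matrix (Fin (2 + 2)) (Fin (2 + 2)) (AdeleRing (𝓞 L) L)) =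
        (SA : Matrix (Fin (2 + 2)) (Fin (2 + 2)) (AdeleRing (𝓞 L) L)) *
          ((adelicVal (Fp L) L (IsCMField.complexConj L) (2 + 2) _ g : GL (Fin (2 + 2)) (AdeleRing (𝓞 L) L)) :
            Matrix (Fin (2 + 2)) (Fin (2 + 2)) (AdeleRing (𝓞 L) L)) *
          ((SA⁻¹ : GL (Fin (2 + 2)) (AdeleRing (𝓞 L) L)) : Matrix (Fin (2 + 2)) (Fin (2 + 2)) (AdeleRing (𝓞 L) L)))
    (ha : a + a = 1)
    (hSA : Matrix.reindex (e₂ (n := 2)).symm (e₂ (n := 2)).symm (SA : Matrix (Fin (2 + 2)) (Fin (2 + 2)) (AdeleRing (𝓞 L) L)) =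
      Matrix.fromBlocks (1 : Matrix (Fin 2) (Fin 2) (AdeleRing (𝓞 L) L)) (X.map ((algebraMap L (AdeleRing (𝓞 L) L)).comp (algebraMap (Fp L) L))) 1
        (-(X.map ((algebraMap L (AdeleRing (𝓞 L) L)).comp (algebraMap (Fp L) L)))))
    (hSAi : Matrix.reindex (e₂ (n := 2)).symm (e₂ (n := 2)).symm ((SA⁻¹ : GL (Fin (2 + 2)) (AdeleRing (𝓞 L) L)) : Matrix (Fin (2 + 2)) (Fin (2 + 2)) (AdeleRing (𝓞 L) L)) =
      Matrix.fromBlocks ((a • (1 : Matrix (Fin 2) (Fin 2) (Fp L))).map ((algebraMap L (AdeleRing (𝓞 L) L)).comp (algebraMap (Fp L) L)))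
        ((a • (1 : Matrix (Fin 2) (Fin 2) (Fp L))).map ((algebraMap L (AdeleRing (𝓞 L) L)).comp (algebraMap (Fp L) L)))
        (Y.map ((algebraMap L (AdeleRing (𝓞 L) L)).comp (algebraMap (Fp L) L)))
        (-(Y.map ((algebraMap L (AdeleRing (𝓞 L) L)).comp (algebraMap (Fp L) L)))))
    (hXY : X * Y = a • (1 : Matrix (Fin 2) (Fin 2) (Fp L))) (hYX : Y * X = a • (1 : Matrix (Fin 2) (Fin 2) (Fp L)))
    {p : unitaryGroupOfForm ((IsCMField.complexConj L : L ≃ₐ[Fp L] L) : L →+* L) ((StdForm.antidiagonal 4).over L)}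
    (hp : p ∈ siegelFour L ((IsCMField.complexConj L : L ≃ₐ[Fp L] L) : L →+* L)) (γ : ratH L e dV hdV dW hdW) :
    (Quotient.mk (MulAction.orbitRel (siegelDeltaRat L e dV hdV dW hdW) (ratH L e dV hdV dW hdW))
        (⟨Ψ (UnitaryGroup.toAdelic (Fp L) L (IsCMField.complexConj L) (2 + 2) ((StdForm.antidiagonal (2 + 2)).over L) p),
            transport_toAdelic_mem_ratH hΨ ha hSA hSAi hXY hYX p⟩ * γ) : SiegelDeltaQuot L e dV hdV dW hdW) =
      Quotient.mk _ γ := by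
  refine Quotient.sound (MulAction.orbitRel_apply.2 (MulAction.mem_orbit_iff.2 ?_))
  refine ⟨⟨⟨Ψ (UnitaryGroup.toAdelic (Fp L) L (IsCMField.complexConj L) (2 + 2) ((StdForm.antidiagonal (2 + 2)).over L) p),
    transport_toAdelic_mem_ratH hΨ ha hSA hSAi hXY hYX p⟩, ?_⟩, rfl⟩
  rw [siegelDeltaRat, Subgroup.mem_subgroupOf, mem_siegelDelta_iff]
  exact isSiegelDelta_transport_toAdelic_of_mem_siegelFour hΨ ha hSA hSAi hYX hp

/-! ## §3 The two cells of `H(L⁺)` and of `P_Δ(L⁺)\H(L⁺)` (`n = 2`) -/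

/-- **THE TWO CELLS OF `H(L⁺)`**: every `γ ∈ H(L⁺)` is `Ψ(toAdelic p)·Ψ(toAdelic q)` or `Ψ(toAdelic p)·Ψ(toAdelic ξ)·Ψ(toAdelic q)` with `p ∈ P(L⁺)`, `q ∈ Q(L⁺)` (★ F2 at `K := L`
through 📤 F3″ `transport_symm_mem_range`). [cite: Xiong2013, §7 Lemma 7.1] [cite: GanTakeda2011SiegelWeil, §7.2 p. 23] -/
theorem ratH_two_cells {SA : GL (Fin (2 + 2)) (AdeleRing (𝓞 L) L)}
    {Ψ : (quasiSplit (Fp L) L (IsCMField.complexConj L) (2 + 2)).Adelic ≃ₜ* HA L e dV hdV dW hdW} {X Y : Matrix (Fin 2) (Fin 2) (Fp L)} {a : Fp L}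
    (hΨ : ∀ g : (quasiSplit (Fp L) L (IsCMField.complexConj L) (2 + 2)).Adelic,
      (((Ψ g : HA L e dV hdV dW hdW) : GL (Fin (2 + 2)) (AdeleRing (𝓞 L) L)) : Matrix (Fin (2 + 2)) (Fin (2 + 2)) (AdeleRing (𝓞 L) L)) =
        (SA : Matrix (Fin (2 + 2)) (Fin (2 + 2)) (AdeleRing (𝓞 L) L)) *
          ((adelicVal (Fp L) L (IsCMField.complexConj L) (2 + 2) _ g : GL (Fin (2 + 2)) (AdeleRing (𝓞 L) L)) :
            Matrix (Fin (2 + 2)) (Fin (2 + 2)) (AdeleRing (𝓞 L) L)) *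
          ((SA⁻¹ : GL (Fin (2 + 2)) (AdeleRing (𝓞 L) L)) : Matrix (Fin (2 + 2)) (Fin (2 + 2)) (AdeleRing (𝓞 L) L)))
    (ha : a + a = 1)
    (hSA : Matrix.reindex (e₂ (n := 2)).symm (e₂ (n := 2)).symm (SA : Matrix (Fin (2 + 2)) (Fin (2 + 2)) (AdeleRing (𝓞 L) L)) =
      Matrix.fromBlocks (1 : Matrix (Fin 2) (Fin 2) (AdeleRing (𝓞 L) L)) (X.map ((algebraMap L (AdeleRing (𝓞 L) L)).comp (algebraMap (Fp L) L))) 1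
        (-(X.map ((algebraMap L (AdeleRing (𝓞 L) L)).comp (algebraMap (Fp L) L)))))
    (hSAi : Matrix.reindex (e₂ (n := 2)).symm (e₂ (n := 2)).symm ((SA⁻¹ : GL (Fin (2 + 2)) (AdeleRing (𝓞 L) L)) : Matrix (Fin (2 + 2)) (Fin (2 + 2)) (AdeleRing (𝓞 L) L)) =
      Matrix.fromBlocks ((a • (1 : Matrix (Fin 2) (Fin 2) (Fp L))).map ((algebraMap L (AdeleRing (𝓞 L) L)).comp (algebraMap (Fp L) L)))
        ((a • (1 : Matrix (Fin 2) (Fin 2) (Fp L))).map ((algebraMap L (AdeleRing (𝓞 L) L)).comp (algebraMap (Fp L) L)))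
        (Y.map ((algebraMap L (AdeleRing (𝓞 L) L)).comp (algebraMap (Fp L) L)))
        (-(Y.map ((algebraMap L (AdeleRing (𝓞 L) L)).comp (algebraMap (Fp L) L)))))
    (hXY : X * Y = a • (1 : Matrix (Fin 2) (Fin 2) (Fp L))) (hYX : Y * X = a • (1 : Matrix (Fin 2) (Fin 2) (Fp L)))
    {γ : HA L e dV hdV dW hdW} (hγ : γ ∈ ratH L e dV hdV dW hdW) :
    ∃ p ∈ siegelFour L ((IsCMField.complexConj L : L ≃ₐ[Fp L] L) : L →+* L), ∃ q ∈ klingen L ((IsCMField.complexConj L : L ≃ₐ[Fp L] L) : L →+* L),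
      γ = Ψ (UnitaryGroup.toAdelic (Fp L) L (IsCMField.complexConj L) (2 + 2) ((StdForm.antidiagonal (2 + 2)).over L) p) *
            Ψ (UnitaryGroup.toAdelic (Fp L) L (IsCMField.complexConj L) (2 + 2) ((StdForm.antidiagonal (2 + 2)).over L) q) ∨
        γ = Ψ (UnitaryGroup.toAdelic (Fp L) L (IsCMField.complexConj L) (2 + 2) ((StdForm.antidiagonal (2 + 2)).over L) p) *
            Ψ (UnitaryGroup.toAdelic (Fp L) L (IsCMField.complexConj L) (2 + 2) ((StdForm.antidiagonal (2 + 2)).over L)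
              (weylXi L ((IsCMField.complexConj L : L ≃ₐ[Fp L] L) : L →+* L))) *
            Ψ (UnitaryGroup.toAdelic (Fp L) L (IsCMField.complexConj L) (2 + 2) ((StdForm.antidiagonal (2 + 2)).over L) q) := by
  obtain ⟨g, hg⟩ := transport_symm_mem_range hΨ ha hSA hSAi hXY hYX hγ
  have hγ' : γ = Ψ (UnitaryGroup.toAdelic (Fp L) L (IsCMField.complexConj L) (2 + 2) ((StdForm.antidiagonal (2 + 2)).over L) g) := by
    rw [hg, ContinuousMulEquiv.apply_symm_apply]
  rcases (siegel_klingen_dichotomy (complexConj_ringHom_apply_apply L) g).1 with ⟨p, hp, q, hq, hgpq⟩ | ⟨p, hp, q, hq, hgpq⟩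
  · refine ⟨p, hp, q, hq, Or.inl ?_⟩
    rw [hγ', hgpq, transport_toAdelic_mul]
  · refine ⟨p, hp, q, hq, Or.inr ?_⟩
    rw [hγ', hgpq, transport_toAdelic_mul, transport_toAdelic_mul]

/-- **… AND NOT BOTH** (★ F2 disjointness, `Ψ` and `toAdelic` injective). [cite: Xiong2013, §7 Lemma 7.1] -/
theorem ratH_two_cells_disjoint (Ψ : (quasiSplit (Fp L) L (IsCMField.complexConj L) (2 + 2)).Adelic ≃ₜ* HA L e dV hdV dW hdW)
    {p q p' q' : unitaryGroupOfForm ((IsCMField.complexConj L : L ≃ₐ[Fp L] L) : L →+* L) ((StdForm.antidiagonal 4).over L)}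
    (hp : p ∈ siegelFour L ((IsCMField.complexConj L : L ≃ₐ[Fp L] L) : L →+* L)) (hq : q ∈ klingen L ((IsCMField.complexConj L : L ≃ₐ[Fp L] L) : L →+* L))
    (hp' : p' ∈ siegelFour L ((IsCMField.complexConj L : L ≃ₐ[Fp L] L) : L →+* L)) (hq' : q' ∈ klingen L ((IsCMField.complexConj L : L ≃ₐ[Fp L] L) : L →+* L))
    (h : Ψ (UnitaryGroup.toAdelic (Fp L) L (IsCMField.complexConj L) (2 + 2) ((StdForm.antidiagonal (2 + 2)).over L) p) *
          Ψ (UnitaryGroup.toAdelic (Fp L) L (IsCMField.complexConj L) (2 + 2) ((StdForm.antidiagonal (2 + 2)).over L) q) =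
        Ψ (UnitaryGroup.toAdelic (Fp L) L (IsCMField.complexConj L) (2 + 2) ((StdForm.antidiagonal (2 + 2)).over L) p') *
          Ψ (UnitaryGroup.toAdelic (Fp L) L (IsCMField.complexConj L) (2 + 2) ((StdForm.antidiagonal (2 + 2)).over L)
            (weylXi L ((IsCMField.complexConj L : L ≃ₐ[Fp L] L) : L →+* L))) *
          Ψ (UnitaryGroup.toAdelic (Fp L) L (IsCMField.complexConj L) (2 + 2) ((StdForm.antidiagonal (2 + 2)).over L) q')) : False := by
  rw [← transport_toAdelic_mul, ← transport_toAdelic_mul, ← transport_toAdelic_mul] at h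
  have h' := toAdelic_injective' L (2 + 2) (Ψ.injective h)
  exact (siegel_klingen_dichotomy (complexConj_ringHom_apply_apply L) (p * q)).2 ⟨⟨p, hp, q, hq, rfl⟩, ⟨p', hp', q', hq', h'⟩⟩

/-- **THE TWO CELLS OF `P_Δ(L⁺)\H(L⁺)`**: every class of `SiegelDeltaQuot` has a representative `Ψ(toAdelic q)` (cell `1`) or `Ψ(toAdelic (ξ·q))` (cell `ξ`) with
`q ∈ Q(L⁺) = klingen L c` — the index sets of the identity cell and of the `ξ`-cell of the Q-constant term. [cite: Xiong2013, §7 Lemma 7.1] [cite: GanTakeda2011SiegelWeil, §7.2 p. 23] -/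
theorem siegelDeltaQuot_two_cells {SA : GL (Fin (2 + 2)) (AdeleRing (𝓞 L) L)}
    {Ψ : (quasiSplit (Fp L) L (IsCMField.complexConj L) (2 + 2)).Adelic ≃ₜ* HA L e dV hdV dW hdW} {X Y : Matrix (Fin 2) (Fin 2) (Fp L)} {a : Fp L}
    (hΨ : ∀ g : (quasiSplit (Fp L) L (IsCMField.complexConj L) (2 + 2)).Adelic,
      (((Ψ g : HA L e dV hdV dW hdW) : GL (Fin (2 + 2)) (AdeleRing (𝓞 L) L)) : Matrix (Fin (2 + 2)) (Fin (2 + 2)) (AdeleRing (𝓞 L) L)) =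
        (SA : Matrix (Fin (2 + 2)) (Fin (2 + 2)) (AdeleRing (𝓞 L) L)) *
          ((adelicVal (Fp L) L (IsCMField.complexConj L) (2 + 2) _ g : GL (Fin (2 + 2)) (AdeleRing (𝓞 L) L)) :
            Matrix (Fin (2 + 2)) (Fin (2 + 2)) (AdeleRing (𝓞 L) L)) *
          ((SA⁻¹ : GL (Fin (2 + 2)) (AdeleRing (𝓞 L) L)) : Matrix (Fin (2 + 2)) (Fin (2 + 2)) (AdeleRing (𝓞 L) L)))
    (ha : a + a = 1)
    (hSA : Matrix.reindex (e₂ (n := 2)).symm (e₂ (n := 2)).symm (SA : Matrix (Fin (2 + 2)) (Fin (2 + 2)) (AdeleRing (𝓞 L) L)) =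
      Matrix.fromBlocks (1 : Matrix (Fin 2) (Fin 2) (AdeleRing (𝓞 L) L)) (X.map ((algebraMap L (AdeleRing (𝓞 L) L)).comp (algebraMap (Fp L) L))) 1
        (-(X.map ((algebraMap L (AdeleRing (𝓞 L) L)).comp (algebraMap (Fp L) L)))))
    (hSAi : Matrix.reindex (e₂ (n := 2)).symm (e₂ (n := 2)).symm ((SA⁻¹ : GL (Fin (2 + 2)) (AdeleRing (𝓞 L) L)) : Matrix (Fin (2 + 2)) (Fin (2 + 2)) (AdeleRing (𝓞 L) L)) =
      Matrix.fromBlocks ((a • (1 : Matrix (Fin 2) (Fin 2) (Fp L))).map ((algebraMap L (AdeleRing (𝓞 L) L)).comp (algebraMap (Fp L) L)))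
        ((a • (1 : Matrix (Fin 2) (Fin 2) (Fp L))).map ((algebraMap L (AdeleRing (𝓞 L) L)).comp (algebraMap (Fp L) L)))
        (Y.map ((algebraMap L (AdeleRing (𝓞 L) L)).comp (algebraMap (Fp L) L)))
        (-(Y.map ((algebraMap L (AdeleRing (𝓞 L) L)).comp (algebraMap (Fp L) L)))))
    (hXY : X * Y = a • (1 : Matrix (Fin 2) (Fin 2) (Fp L))) (hYX : Y * X = a • (1 : Matrix (Fin 2) (Fin 2) (Fp L)))
    (x : SiegelDeltaQuot L e dV hdV dW hdW) :
    ∃ q ∈ klingen L ((IsCMField.complexConj L : L ≃ₐ[Fp L] L) : L →+* L),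
      x = Quotient.mk (MulAction.orbitRel (siegelDeltaRat L e dV hdV dW hdW) (ratH L e dV hdV dW hdW))
            ⟨Ψ (UnitaryGroup.toAdelic (Fp L) L (IsCMField.complexConj L) (2 + 2) ((StdForm.antidiagonal (2 + 2)).over L) q),
              transport_toAdelic_mem_ratH hΨ ha hSA hSAi hXY hYX q⟩ ∨
        x = Quotient.mk (MulAction.orbitRel (siegelDeltaRat L e dV hdV dW hdW) (ratH L e dV hdV dW hdW))
            ⟨Ψ (UnitaryGroup.toAdelic (Fp L) L (IsCMField.complexConj L) (2 + 2) ((StdForm.antidiagonal (2 + 2)).over L)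
                (weylXi L ((IsCMField.complexConj L : L ≃ₐ[Fp L] L) : L →+* L) * q)),
              transport_toAdelic_mem_ratH hΨ ha hSA hSAi hXY hYX _⟩ := by
  induction x using Quotient.inductionOn with
  | h γ =>
    obtain ⟨p, hp, q, hq, hcell⟩ := ratH_two_cells hΨ ha hSA hSAi hXY hYX γ.2
    refine ⟨q, hq, ?_⟩
    rcases hcell with h1 | h2
    · left
      have hγ : γ = ⟨Ψ (UnitaryGroup.toAdelic (Fp L) L (IsCMField.complexConj L) (2 + 2) ((StdForm.antidiagonal (2 + 2)).over L) p),
            transport_toAdelic_mem_ratH hΨ ha hSA hSAi hXY hYX p⟩ *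
          ⟨Ψ (UnitaryGroup.toAdelic (Fp L) L (IsCMField.complexConj L) (2 + 2) ((StdForm.antidiagonal (2 + 2)).over L) q),
            transport_toAdelic_mem_ratH hΨ ha hSA hSAi hXY hYX q⟩ := Subtype.ext h1
      rw [hγ, mk_transport_siegelFour_mul hΨ ha hSA hSAi hXY hYX hp]
    · right
      have hγ : γ = ⟨Ψ (UnitaryGroup.toAdelic (Fp L) L (IsCMField.complexConj L) (2 + 2) ((StdForm.antidiagonal (2 + 2)).over L) p),
            transport_toAdelic_mem_ratH hΨ ha hSA hSAi hXY hYX p⟩ *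
          ⟨Ψ (UnitaryGroup.toAdelic (Fp L) L (IsCMField.complexConj L) (2 + 2) ((StdForm.antidiagonal (2 + 2)).over L)
              (weylXi L ((IsCMField.complexConj L : L ≃ₐ[Fp L] L) : L →+* L) * q)),
            transport_toAdelic_mem_ratH hΨ ha hSA hSAi hXY hYX _⟩ := by
        refine Subtype.ext ?_
        show γ.1 = Ψ (UnitaryGroup.toAdelic (Fp L) L (IsCMField.complexConj L) (2 + 2) ((StdForm.antidiagonal (2 + 2)).over L) p) *
          Ψ (UnitaryGroup.toAdelic (Fp L) L (IsCMField.complexConj L) (2 + 2) ((StdForm.antidiagonal (2 + 2)).over L)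
            (weylXi L ((IsCMField.complexConj L : L ≃ₐ[Fp L] L) : L →+* L) * q))
        rw [h2, transport_toAdelic_mul, mul_assoc]
      rw [hγ, mk_transport_siegelFour_mul hΨ ha hSA hSAi hXY hYX hp]

end Summit.HodgeConjecture.HodgeConjecture.Cruxes.HLiu418.K2LiuKlingenRationalCells

end
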